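import Summits.QuantumFields.YangMills.Theorems.BalabanLadderUVTorusClassDefs
import Summits.QuantumFields.YangMills.Theorems.LangevinControlUVOSLegsFromFemtoAndGapStubCollar6
import HarnessLib

/-!
# Route `BalabanLadder`, torus-parity junction: the femto collar feeds the class-parametric ceilings on tori of EVERY side

Helper file (`--supports stmt-QuantumFields-19356`, fleet seat `ym-osasm-p2`, director-ym R136 (iii); KNIT 5 «On-variant» of the femto feed);
pure theorems.  The route owner's ruling on the torus-parity junction (ym-beyond-p2 g20, 2026-08-26T18:15:51Z; (A): «the seam is REAL and
UN-TYPED under every Track-A → Y2 feeder; femto `CFP` and everything downstream of the legs unaffected») adopted the class-parametric currency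
`Cruxes.UV.TorusClass.MomentBounds6OnSides G r a 𝓣` (★ym-osasm-p1, p464599: VERBATIM `MomentBounds6` with `2S+1 ↦ M ∈ 𝓣`, half-side clause
`8R+16 ≤ M`, cyclic separation in `ZMod M`).  THIS FILE is the kernel certificate of the second half of (A) for the CEILINGS: the plane-resolved
frozen-boundary femto law `FBL6 G r a` collars to `MomentBounds6OnSides G r a 𝓣` for EVERY class `𝓣` — odd, even, Track A's `familySides`,
`Set.univ` — because the collar mechanism (one torus-DLR step per site, tree `abs_integral_prod_sub_mean_le`, Georgii Thm 4.17) is stated and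
proved in the tree for the Wilson state on `(ℤ/Lℤ)ᵈ` of ANY side `L` (`[NeZero L]`); only the two geometric side conditions of the landed
odd-torus proof `DlrCollarTransfer.stub_collar6` (p-landed, `…StubCollar6.lean`) mention `2L+1`, and both hold verbatim at a raw side `M ≥ 8R+16`:

* §1 `injOn_torusProj_cube_side` — reduction mod `M` is injective on the radius-`R+2` neighbourhood of the cube around a site (`2(R+2) < M`);
  `torusEdge_ne_cube_side` — cubes around sites at cyclic distance `≥ 2R+4` in `ZMod M` do not meet on `(ℤ/Mℤ)⁴`.
* §2 **`momentBounds6OnSides_of_fbl6 : FBL6 G r a → MomentBounds6OnSides G r a 𝓣`** (every compact `G`, every `r`, `a`, `𝓣`; constants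
  `2C₁, β₁, ℓ₁/5` exactly as in `stub_collar6`), with the named instances `…_univ_of_fbl6` (all sides) and `…_familySides_of_fbl6` (Track A's
  even class); at `𝓣 = {M | Odd M}` it is `stub_collar6` again through p1's `momentBounds6OnSides_odd_iff` (not re-declared).

Consequence for the census (§6 KNIT 5): the femto feed of the ceilings (`Theorems/BalabanLadderUVOtherGroupsFemto.lean` `legs_of_cfp6`, any
compact `G`) lands in the (c′) currency on ANY side class with NO parity seam and no volume transfer; the seam sits only under the APEX feeders
(Track A's `UV` on even family tori).  HONEST FRAMING: bookkeeping of a CONDITIONAL chain (0∕6 legs); `FBL6` is OWED (femto package, crux 9367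
lineage); not a gap, not Clay.  Refs: H.-O. Georgii, de Gruyter Stud. Math. 9 (2011) Thm 4.17; E. Seiler, LNP 159 (1982) Ch. 2.
-/

set_option autoImplicit false

noncomputable section

open MeasureTheory Filter Topology
open Literature.MathematicalPhysics.QuantumFieldTheory Literature.MathematicalPhysics.QuantumLattice
open Literature.MathematicalPhysics.AQFT Literature.Probability.LatticeModels
open Summit.QuantumFields.YangMills.Cruxes.OSLegsFromFemtoAndGap.DlrCollarTransfer

namespace Summit.QuantumFields.YangMills.Cruxes.UV.TorusClass

/-! ## §1 Cube geometry on the raw torus `(ℤ/Mℤ)⁴` -/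

section CubeGeometry

/-- **Injectivity side condition at a raw side**: the cube of radius `R+1` around `x` and the edges of the plaquettes touching it lie in the
sup-ball of radius `R+2` around `x`, on which reduction mod `M` is injective when `8R+16 ≤ M` (indeed `2R+5 ≤ M` suffices; tree
`injOn_torusProj_of_near`).  The raw-side form of `DlrCollarTransfer.injOn_torusProj_cube` (`M = 2L+1`, `4R+8 ≤ L`). [folklore] -/
theorem injOn_torusProj_cube_side {M R : ℕ} (hRM : 8 * R + 16 ≤ M) (x : Fin 4 → ℤ) :
    Set.InjOn (Torus.proj M)
      (((cubeEdges (fun k => x k - (R + 1)) (2 * R + 3) ∪ cubeEdges (fun k => x k - (R + 1)) (2 * R + 3) ∪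
          (plaquettesTouching (cubeEdges (fun k => x k - (R + 1)) (2 * R + 3))).biUnion plaquetteEdges).image
          Prod.fst : Set (Fin 4 → ℤ))) := by
  refine (injOn_torusProj_of_near (M := M) x (ϱ := (R : ℤ) + 2) (by omega)).mono ?_
  intro y hy
  obtain ⟨e, he, rfl⟩ := Finset.mem_image.1 (Finset.mem_coe.1 hy)
  simp only [Set.mem_setOf_eq]
  rcases Finset.mem_union.1 he with he | he
  · rw [Finset.union_idempotent] at he
    exact fun j => (near_of_mem_cubeSites_centred (fst_mem_cubeSites_of_mem_cubeEdges he) j).trans (by linarith)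
  · exact near_of_mem_boundary_centred he

/-- **Separation side condition at a raw side**: if `x` and `x'` are at cyclic distance `≥ 2R+4` in `ZMod M` in some coordinate, then the cube of
radius `R+1` around `x'` together with its boundary plaquette edges (radius `R+2`) does not meet the cube of radius `R+1` around `x` on
`(ℤ/Mℤ)⁴` (tree `torusEdge_ne_of_separated`).  The raw-side form of `DlrCollarTransfer.torusEdge_ne_cube`. [folklore] -/
theorem torusEdge_ne_cube_side {M R : ℕ} [NeZero M] {x x' : Fin 4 → ℤ}
    (hsep : ∃ k : Fin 4, (2 * (R : ℤ) + 4) ≤ |((((x k - x' k : ℤ) : ZMod M)).valMinAbs : ℤ)|)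
    {e e' : Literature.MathematicalPhysics.QuantumLattice.ZdEdge 4}
    (he : e ∈ cubeEdges (fun k => x' k - (R + 1)) (2 * R + 3) ∪
      (plaquettesTouching (cubeEdges (fun k => x' k - (R + 1)) (2 * R + 3))).biUnion plaquetteEdges)
    (he' : e' ∈ cubeEdges (fun k => x k - (R + 1)) (2 * R + 3)) :
    torusEdge M e ≠ torusEdge M e' := by
  obtain ⟨k, hk⟩ := hsep
  have hnear : ∀ j, |e.1 j - x' j| ≤ (R : ℤ) + 2 := by
    rcases Finset.mem_union.1 he with h | h
    · exact fun j => (near_of_mem_cubeSites_centred (fst_mem_cubeSites_of_mem_cubeEdges h) j).trans (by linarith)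
    · exact near_of_mem_boundary_centred h
  have hnear' : ∀ j, |e'.1 j - x j| ≤ (R : ℤ) + 1 := fun j =>
    near_of_mem_cubeSites_centred (fst_mem_cubeSites_of_mem_cubeEdges he') j
  exact torusEdge_ne_of_separated (ϱ := (R : ℤ) + 1) (ϱ' := (R : ℤ) + 2) (by linarith) hnear hnear'

end CubeGeometry

/-! ## §2 `FBL6 ⇒ MomentBounds6OnSides` on every class of raw sides -/

section Transfer

variable {G : Type} [Group G] [TopologicalSpace G] [IsTopologicalGroup G] [CompactSpace G]
  [MeasurableSpace G] [BorelSpace G] (r : LatticeRep G) (a : ℝ → ℝ)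

/-- **THE FEMTO COLLAR IS PARITY-FREE**: `FBL6 G r a → MomentBounds6OnSides G r a 𝓣` for every compact `G`, lattice representation `r`, unit
map `a` and EVERY class of raw torus sides `𝓣` — the plane-resolved frozen-boundary femto law (kernel means of the single-plane field at depth
`d` within `C₁/d⁴` of `p q β`, for every exterior) collars to `(2C₁/R⁴)ⁿ` bounds on the centred mixed moments of single-plane fields at pairwise
cyclically separated sites on the torus `(ℤ/Mℤ)⁴` of ANY side `M ≥ 8R+16`, `M ∈ 𝓣`.  Proof = the landed `DlrCollarTransfer.stub_collar6` with
`2L+1 ↦ M`: one torus-DLR step per site (tree `abs_integral_prod_sub_mean_le`, side-generic) on the radius-`R+1` cubes, shifted observables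
`plane (q i) (x i) − p (q i) β`, `FBL6` at the cube centres (`abs_kerE_plane_centred_sub_le`), geometry §1.  [folklore: Georgii (2011) Thm 4.17
for a nearest-neighbour plaquette interaction, Seiler LNP 159 Ch. 2] -/
theorem momentBounds6OnSides_of_fbl6 (𝓣 : Set ℕ) (hFBL : FBL6 G r a) : MomentBounds6OnSides G r a 𝓣 := by
  obtain ⟨C₁, β₁, ℓ₁, p, hℓ₁, hC₁, hF⟩ := hFBL
  refine ⟨2 * C₁, β₁, ℓ₁ / 5, by positivity, by positivity, ?_⟩
  intro β hβ M _ _ n q x R hq hR hRa hRM hsep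
  haveI : SecondCountableTopology G :=
    (r.continuous.isClosedEmbedding r.injective).isEmbedding.secondCountableTopology
  haveI := isProbabilityMeasure_wilsonMeasure (d := 4) (L := M) r.ρ r.continuous β
  obtain ⟨CA, hCA⟩ := exists_abs_plane_le r
  -- the cubes of side `2R+3` are femto cubes
  have hb : ((2 * R + 3 : ℕ) : ℝ) * a β ≤ ℓ₁ := by
    rcases le_or_gt 0 (a β) with ha | ha
    · have h5 : ((2 * R + 3 : ℕ) : ℝ) ≤ 5 * R := by
        have : (1 : ℝ) ≤ R := by exact_mod_cast hR
        push_cast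
        linarith
      calc ((2 * R + 3 : ℕ) : ℝ) * a β ≤ 5 * R * a β := mul_le_mul_of_nonneg_right h5 ha
        _ = 5 * ((R : ℝ) * a β) := by ring
        _ ≤ 5 * (ℓ₁ / 5) := by gcongr
        _ = ℓ₁ := by ring
    · have : ((2 * R + 3 : ℕ) : ℝ) * a β ≤ 0 := mul_nonpos_of_nonneg_of_nonpos (by positivity) ha.le
      linarith
  have hmeas : ∀ i : Fin n, Measurable (plane G r (q i) (x i)) := fun i =>
    (continuous_plane r (q i) (x i)).measurable
  have hAc : ∀ i : Fin n, Continuous fun U => plane G r (q i) (x i) U - p (q i) β := fun i =>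
    (continuous_plane r (q i) (x i)).sub continuous_const
  have hAb : ∀ (i : Fin n) (U : LGConfig 4 G), |plane G r (q i) (x i) U - p (q i) β| ≤ CA + ∑ j, |p (q j) β| :=
    fun i U => (abs_sub _ _).trans (add_le_add (hCA _ _ _)
      (Finset.single_le_sum (f := fun j => |p (q j) β|) (fun j _ => abs_nonneg _) (Finset.mem_univ i)))
  have hAS : ∀ i : Fin n, IsCylinder (fun U => plane G r (q i) (x i) U - p (q i) β)
      (cubeEdges (fun k => x i k - (R + 1)) (2 * R + 3)) :=
    fun i U V hUV => by simp only [isCylinder_plane_cube r hR (q i) (x i) hUV]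
  have hinj : ∀ i : Fin n, Set.InjOn (Torus.proj M)
      (((cubeEdges (fun k => x i k - (R + 1)) (2 * R + 3) ∪ cubeEdges (fun k => x i k - (R + 1)) (2 * R + 3) ∪
          (plaquettesTouching (cubeEdges (fun k => x i k - (R + 1)) (2 * R + 3))).biUnion plaquetteEdges).image
          Prod.fst : Set (Fin 4 → ℤ))) := fun i => injOn_torusProj_cube_side hRM (x i)
  have hfar : ∀ i j : Fin n, i ≠ j → ∀ e ∈ cubeEdges (fun k => x j k - (R + 1)) (2 * R + 3) ∪
      (plaquettesTouching (cubeEdges (fun k => x j k - (R + 1)) (2 * R + 3))).biUnion plaquetteEdges,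
      ∀ e' ∈ cubeEdges (fun k => x i k - (R + 1)) (2 * R + 3),
      torusEdge M e ≠ torusEdge M e' :=
    fun i j hij e he e' he' => torusEdge_ne_cube_side (hsep i j hij) he he'
  have hm : ∀ i : Fin n, torusEOn G r β M (plane G r (q i) (x i)) - p (q i) β =
      ∫ W, (plane G r (q i) (x i) (torusLift M W) - p (q i) β)
        ∂(wilsonMeasure (d := 4) (L := M) r.ρ β) := fun i =>
    (integral_sub_const_of_abs_le (μ := wilsonMeasure (d := 4) (L := M) r.ρ β)
      ((continuous_plane r (q i) (x i)).comp (continuous_torusLift M)).measurable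
      (fun W => hCA (q i) (x i) (torusLift M W)) (p (q i) β)).symm
  have hker : ∀ (i : Fin n) (η : LGConfig 4 G),
      |(∫ U, (plane G r (q i) (x i) U - p (q i) β) ∂(ymSpecification r.ρ β
        (cubeEdges (fun k => x i k - (R + 1)) (2 * R + 3)) η)) - 0| ≤ C₁ / (R : ℝ) ^ 4 := fun i η => by
    haveI := isProbabilityMeasure_ymSpecification r.ρ r.continuous β
      (cubeEdges (fun k => x i k - (R + 1)) (2 * R + 3)) η
    rw [sub_zero, integral_sub_const_of_abs_le (hmeas i) (fun U => hCA (q i) (x i) U) (p (q i) β)]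
    exact abs_kerE_plane_centred_sub_le r hC₁ (hF β hβ) (hq i) hR hb (x i) η
  have key : |∫ V, ∏ i, (plane G r (q i) (x i) (torusLift M V) - p (q i) β -
      (torusEOn G r β M (plane G r (q i) (x i)) - p (q i) β)) ∂(wilsonMeasure (d := 4) (L := M) r.ρ β)| ≤
      (2 * (C₁ / (R : ℝ) ^ 4)) ^ n :=
    abs_integral_prod_sub_mean_le (d := 4) r.ρ r.continuous β (L := M) (n := n)
      (fun i => cubeEdges (fun k => x i k - (R + 1)) (2 * R + 3))
      (fun i => cubeEdges (fun k => x i k - (R + 1)) (2 * R + 3))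
      (fun i U => plane G r (q i) (x i) U - p (q i) β) hAc hAb hAS hinj hfar
      (fun i => torusEOn G r β M (plane G r (q i) (x i)) - p (q i) β) hm hker
  simp only [sub_sub_sub_cancel_right] at key
  rw [show (2 : ℝ) * C₁ / (R : ℝ) ^ 4 = 2 * (C₁ / (R : ℝ) ^ 4) from mul_div_assoc _ _ _]
  exact key

/-- **All sides**: the femto law collars on the tori of every side `M ≥ 8R+16`, both parities (`𝓣 = Set.univ`). -/
theorem momentBounds6OnSides_univ_of_fbl6 (hFBL : FBL6 G r a) : MomentBounds6OnSides G r a Set.univ :=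
  momentBounds6OnSides_of_fbl6 r a Set.univ hFBL

/-- **Track A's even class**: the femto law collars on the finest family tori `(ℤ/2L^{m+K}ℤ)⁴` (`𝓣 = familySides`, all EVEN,
`even_of_mem_familySides`) — the femto feed meets Track A's own class with no parity seam. -/
theorem momentBounds6OnSides_familySides_of_fbl6 (hFBL : FBL6 G r a) : MomentBounds6OnSides G r a familySides :=
  momentBounds6OnSides_of_fbl6 r a familySides hFBL

end Transfer

end Summit.QuantumFields.YangMills.Cruxes.UV.TorusClass

end
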